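import Mathlib
import HarnessLib

/-!
# The generator sum of `su(N)`: completeness (Fierz) identities for an explicit weighted family

HONEST FRAMING: exact (Metropolis-corrected) sampling algorithms for lattice gauge theory;
figures of merit are autocorrelation/cost numbers at stated couplings and volumes; no
continuum-physics claim.

Venture `LatticeQCDFlow` (cell pub-lqcd), topic `Exactness`, FANOUT row 9 (eng-latcore; the
engine's reference-free exactness observable `latflow.core.schwinger_dyson.residual_links`,
acceptance test A11).  NEW WORK of the cell over Mathlib (`Matrix.single`, `Finset` sums);
nothing is cited as a fact.  Printed counterparts, named only: the `su(N)` completeness relation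
`Σ_a T^a_{ij} T^a_{kl} = ½ (δ_il δ_jk − δ_ij δ_kl / N)` and the Fierz identity.

`HaarStein.lean` (`gibbs_stein`) and `HaarSteinUnitary.lean` type the Schwinger–Dyson identity
for ONE generator direction; the engine's residual `R_l = C_F tr A + (β/4N)[tr(AA) − tr(A†A) −
(2i/N) Im tr A · tr A]` is the SUM of those identities over a basis of the Lie algebra, closed by
`Σ_a T^a T^a = C_F · 1` and the Fierz identity — "Not here: the sum over generators" in both files,
"open typed item" in `TYPED-EXACTNESS-MAP.md`.  This file supplies that algebra WITHOUT an
orthonormal (Gell-Mann) basis: an explicit weighted family of skew-Hermitian traceless matrices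
whose quadratic sums reproduce the `su(N)` Casimir tensor.

## Content (`n` a finite index type, `N = card n`; `E_ij = Matrix.single i j 1` over `ℂ`)

* the family: `genX i j = E_ij − E_ji`, `genY i j = i (E_ij + E_ji)` (used for `i ≠ j`),
  `genD i j = i (E_ii − E_jj)`; each is skew-Hermitian (`gen*_conjTranspose`) and traceless
  (`gen*_trace`, `genY` for `i ≠ j`).
* `genSum F = Σ_i Σ_{j ≠ i} (1/8) (F (genX i j) + F (genY i j)) + Σ_i Σ_j (1/(4N)) F (genD i j)` —
  the weighted family sum of a scalar function `F`; `genSum_congr` (only the values of `F` on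
  skew-Hermitian traceless matrices matter), `genSum_eq_zero`, `genSum_add`, `genSum_sub`,
  `genSum_const_mul`.
* **`genSum_bilin`** — for every `ℂ`-bilinear `Φ`:
  `genSum (Z ↦ Φ Z Z) = −½ (Σ_i Σ_j Φ E_ij E_ji − Φ 1 1 / N)` (the Casimir tensor
  `Σ_a Z_a ⊗ Z_a = −½ (Σ_ij E_ij ⊗ E_ji − 1 ⊗ 1 / N)` in bilinear-form clothing).
* corollaries used by the residual: **`genSum_trace_sq_mul`** `genSum (Z ↦ tr (Z Z A)) = −C_F tr A`
  with `casimirF N = (N² − 1)/(2N)`; **`genSum_trace_mul_trace`**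
  `genSum (Z ↦ tr (Z P) tr (Z Q)) = −½ (tr (P Q) − tr P tr Q / N)`.
* `star_trace_skew_mul` — for skew-Hermitian `Z`: `conj tr (Z A) = − tr (Z Aᴴ)`, whence
  `re_trace_skew_mul`: `Re tr (Z A) = (tr (Z A) − tr (Z Aᴴ)) / 2` as a complex number.

Not here: the analytic identity itself (`HaarStein*.lean`), the lattice sum over links.
-/

namespace Summit.Ventures.LatticeQCDFlow.Exactness

open Matrix Complex Finset
open scoped ComplexConjugate

variable {n : Type*} [Fintype n] [DecidableEq n]

/-! ## §1 The generator family -/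

/-- `genX i j = E_ij − E_ji` (real antisymmetric direction). -/
def genX (i j : n) : Matrix n n ℂ := single i j 1 - single j i 1

/-- `genY i j = i (E_ij + E_ji)` (imaginary symmetric direction; traceless for `i ≠ j`). -/
def genY (i j : n) : Matrix n n ℂ := (I : ℂ) • (single i j 1 + single j i 1)

/-- `genD i j = i (E_ii − E_jj)` (diagonal direction). -/
def genD (i j : n) : Matrix n n ℂ := (I : ℂ) • (single i i 1 - single j j 1)

omit [Fintype n] in
/-- `genX` is skew-Hermitian. -/
theorem genX_conjTranspose (i j : n) : (genX i j)ᴴ = -genX i j := by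
  unfold genX
  rw [conjTranspose_sub, conjTranspose_single, conjTranspose_single, star_one, neg_sub]

omit [Fintype n] in
/-- `genY` is skew-Hermitian. -/
theorem genY_conjTranspose (i j : n) : (genY i j)ᴴ = -genY i j := by
  unfold genY
  rw [conjTranspose_smul, conjTranspose_add, conjTranspose_single, conjTranspose_single, star_one,
    Complex.star_def, Complex.conj_I, neg_smul, add_comm]

omit [Fintype n] in
/-- `genD` is skew-Hermitian. -/
theorem genD_conjTranspose (i j : n) : (genD i j)ᴴ = -genD i j := by
  unfold genD
  rw [conjTranspose_smul, conjTranspose_sub, conjTranspose_single, conjTranspose_single, star_one,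
    Complex.star_def, Complex.conj_I, neg_smul]

/-- `tr E_ij = [i = j]`. -/
theorem trace_single_one (i j : n) : (single i j (1 : ℂ)).trace = if i = j then 1 else 0 := by
  split_ifs with h
  · subst h; exact trace_single_eq_same i 1
  · exact trace_single_eq_of_ne i j 1 h

/-- `genX` is traceless. -/
theorem genX_trace (i j : n) : (genX i j).trace = 0 := by
  unfold genX
  rw [trace_sub, trace_single_one, trace_single_one]
  by_cases h : i = j
  · subst h; simp
  · rw [if_neg h, if_neg (Ne.symm h), sub_zero]

/-- `genY i j` is traceless for `i ≠ j`. -/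
theorem genY_trace {i j : n} (h : i ≠ j) : (genY i j).trace = 0 := by
  unfold genY
  rw [trace_smul, trace_add, trace_single_one, trace_single_one, if_neg h, if_neg (Ne.symm h),
    add_zero, smul_zero]

/-- `genD` is traceless. -/
theorem genD_trace (i j : n) : (genD i j).trace = 0 := by
  unfold genD
  rw [trace_smul, trace_sub, trace_single_one, trace_single_one, if_pos rfl, if_pos rfl, sub_self,
    smul_zero]

/-! ## §2 The weighted family sum -/

/-- The weighted sum of a scalar function over the generator family of `su(N)`, `N = card n`:
`Σ_i Σ_{j ≠ i} (1/8) (F (genX i j) + F (genY i j)) + Σ_i Σ_j (1/(4N)) F (genD i j)`. -/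
noncomputable def genSum (F : Matrix n n ℂ → ℂ) : ℂ :=
  (∑ i, ∑ j ∈ univ.erase i, (1 / 8 : ℂ) * (F (genX i j) + F (genY i j)))
    + ∑ i, ∑ j, (1 / (4 * Fintype.card n) : ℂ) * F (genD i j)

/-- Only the values of `F` on skew-Hermitian traceless matrices enter `genSum F`. -/
theorem genSum_congr {F G : Matrix n n ℂ → ℂ}
    (h : ∀ Z : Matrix n n ℂ, Zᴴ = -Z → Z.trace = 0 → F Z = G Z) : genSum F = genSum G := by
  unfold genSum
  congr 1
  · refine sum_congr rfl fun i _ => sum_congr rfl fun j hj => ?_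
    have hij : i ≠ j := (ne_of_mem_erase hj).symm
    rw [h _ (genX_conjTranspose i j) (genX_trace i j),
      h _ (genY_conjTranspose i j) (genY_trace hij)]
  · refine sum_congr rfl fun i _ => sum_congr rfl fun j _ => ?_
    rw [h _ (genD_conjTranspose i j) (genD_trace i j)]

/-- The family sum of the zero function vanishes. -/
theorem genSum_zero : genSum (fun _ : Matrix n n ℂ => (0 : ℂ)) = 0 := by
  simp [genSum]

/-- If `F` vanishes on skew-Hermitian traceless matrices then `genSum F = 0`. -/
theorem genSum_eq_zero {F : Matrix n n ℂ → ℂ}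
    (h : ∀ Z : Matrix n n ℂ, Zᴴ = -Z → Z.trace = 0 → F Z = 0) : genSum F = 0 :=
  (genSum_congr (G := fun _ => 0) h).trans genSum_zero

/-- `genSum` is additive in `F`. -/
theorem genSum_add (F G : Matrix n n ℂ → ℂ) :
    genSum (fun Z => F Z + G Z) = genSum F + genSum G := by
  simp only [genSum, mul_add, sum_add_distrib]
  ring

/-- `genSum` commutes with subtraction. -/
theorem genSum_sub (F G : Matrix n n ℂ → ℂ) :
    genSum (fun Z => F Z - G Z) = genSum F - genSum G := by
  simp only [genSum, mul_sub, mul_add, sum_sub_distrib, sum_add_distrib]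
  ring

/-- `genSum` is homogeneous in `F`. -/
theorem genSum_const_mul (c : ℂ) (F : Matrix n n ℂ → ℂ) :
    genSum (fun Z => c * F Z) = c * genSum F := by
  simp only [genSum, mul_add, mul_sum]
  congr 1
  · refine sum_congr rfl fun i _ => sum_congr rfl fun j _ => ?_; ring
  · refine sum_congr rfl fun i _ => sum_congr rfl fun j _ => ?_; ring

/-! ## §3 The completeness relation in bilinear form -/

omit [Fintype n] in
/-- Per pair: `Φ X X + Φ Y Y = −2 (Φ E_ij E_ji + Φ E_ji E_ij)`. -/
theorem bilin_genX_add_genY (Φ : Matrix n n ℂ →ₗ[ℂ] Matrix n n ℂ →ₗ[ℂ] ℂ) (i j : n) :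
    Φ (genX i j) (genX i j) + Φ (genY i j) (genY i j) =
      -2 * (Φ (single i j 1) (single j i 1) + Φ (single j i 1) (single i j 1)) := by
  simp only [genX, genY, map_add, map_sub, map_smul, LinearMap.add_apply, LinearMap.sub_apply,
    LinearMap.smul_apply, smul_eq_mul]
  have hI : I * I = -1 := Complex.I_mul_I
  linear_combination (Φ (single i j 1) (single i j 1) + Φ (single i j 1) (single j i 1)
    + Φ (single j i 1) (single i j 1) + Φ (single j i 1) (single j i 1)) * hI

omit [Fintype n] in
/-- Per pair: `Φ D D = −(Φ E_ii E_ii − Φ E_ii E_jj − Φ E_jj E_ii + Φ E_jj E_jj)`. -/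
theorem bilin_genD (Φ : Matrix n n ℂ →ₗ[ℂ] Matrix n n ℂ →ₗ[ℂ] ℂ) (i j : n) :
    Φ (genD i j) (genD i j) =
      -(Φ (single i i 1) (single i i 1) - Φ (single i i 1) (single j j 1)
        - Φ (single j j 1) (single i i 1) + Φ (single j j 1) (single j j 1)) := by
  simp only [genD, map_sub, map_smul, LinearMap.sub_apply, LinearMap.smul_apply, smul_eq_mul]
  have hI : I * I = -1 := Complex.I_mul_I
  linear_combination (Φ (single i i 1) (single i i 1) - Φ (single i i 1) (single j j 1)
    - Φ (single j j 1) (single i i 1) + Φ (single j j 1) (single j j 1)) * hI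

/-- `Σ_i Σ_j Φ E_ii E_jj = Φ 1 1`. -/
theorem sum_sum_bilin_diag (Φ : Matrix n n ℂ →ₗ[ℂ] Matrix n n ℂ →ₗ[ℂ] ℂ) :
    ∑ i, ∑ j, Φ (single i i 1) (single j j 1) = Φ 1 1 := by
  simp_rw [← map_sum]
  rw [sum_single_one, ← LinearMap.sum_apply, ← map_sum, sum_single_one]

/-- **Completeness relation of `su(N)` for the weighted family.**  For every `ℂ`-bilinear `Φ`:
`genSum (Z ↦ Φ Z Z) = −½ (Σ_i Σ_j Φ E_ij E_ji − Φ 1 1 / N)`. -/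
theorem genSum_bilin [Nonempty n] (Φ : Matrix n n ℂ →ₗ[ℂ] Matrix n n ℂ →ₗ[ℂ] ℂ) :
    genSum (fun Z => Φ Z Z) =
      -(1 / 2 : ℂ) * (∑ i, ∑ j, Φ (single i j 1) (single j i 1)
        - (1 / Fintype.card n : ℂ) * Φ 1 1) := by
  have hN : (Fintype.card n : ℂ) ≠ 0 := Nat.cast_ne_zero.mpr Fintype.card_ne_zero
  set g : n → n → ℂ := fun i j => Φ (single i j 1) (single j i 1) with hg
  -- the off-diagonal part
  have hA : ∑ i, ∑ j ∈ univ.erase i, (1 / 8 : ℂ) * (Φ (genX i j) (genX i j) + Φ (genY i j) (genY i j))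
      = -(1 / 2 : ℂ) * (∑ i, ∑ j, g i j - ∑ i, g i i) := by
    have h1 : ∀ i, ∑ j ∈ univ.erase i, (1 / 8 : ℂ) * (Φ (genX i j) (genX i j) + Φ (genY i j) (genY i j))
        = -(1 / 4 : ℂ) * (∑ j, (g i j + g j i) - (g i i + g i i)) := by
      intro i
      rw [← sum_erase_eq_sub (mem_univ i), mul_sum]
      refine sum_congr rfl fun j _ => ?_
      rw [bilin_genX_add_genY]
      ring
    simp_rw [h1]
    rw [← mul_sum, sum_sub_distrib]
    simp_rw [sum_add_distrib]
    have hswap : ∑ x, ∑ y, g y x = ∑ x, ∑ y, g x y := sum_comm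
    rw [hswap]
    ring
  -- the diagonal part
  have hB : ∑ i, ∑ j, (1 / (4 * Fintype.card n) : ℂ) * Φ (genD i j) (genD i j)
      = -(1 / 2 : ℂ) * ∑ i, g i i + (1 / (2 * Fintype.card n) : ℂ) * Φ 1 1 := by
    simp_rw [← mul_sum, bilin_genD, sum_neg_distrib, sum_add_distrib, sum_sub_distrib]
    rw [sum_sum_bilin_diag, sum_comm (f := fun i j => Φ (single j j 1) (single i i 1)),
      sum_sum_bilin_diag]
    simp_rw [sum_const, card_univ, nsmul_eq_mul]
    rw [← mul_sum]
    field_simp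
    ring
  unfold genSum
  rw [hA, hB]
  field_simp
  ring

/-! ## §4 The two corollaries used by the Schwinger–Dyson residual -/

/-- The fundamental Casimir `C_F = (N² − 1)/(2N)` (normalisation `tr T^a T^b = δ^{ab}/2`). -/
noncomputable def casimirF (N : ℕ) : ℂ := ((N : ℂ) ^ 2 - 1) / (2 * N)

/-- **`Σ_a Z_a Z_a = −C_F · 1`, traced against `A`:** `genSum (Z ↦ tr (Z Z A)) = −C_F tr A`. -/
theorem genSum_trace_sq_mul [Nonempty n] (A : Matrix n n ℂ) :
    genSum (fun Z => (Z * Z * A).trace) = -casimirF (Fintype.card n) * A.trace := by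
  have hN : (Fintype.card n : ℂ) ≠ 0 := Nat.cast_ne_zero.mpr Fintype.card_ne_zero
  have key := genSum_bilin (LinearMap.mk₂ ℂ (fun S T : Matrix n n ℂ => (S * T * A).trace)
    (fun S₁ S₂ T => by simp only [Matrix.add_mul, trace_add])
    (fun c S T => by simp only [Matrix.smul_mul, trace_smul])
    (fun S T₁ T₂ => by simp only [Matrix.mul_add, Matrix.add_mul, trace_add])
    (fun c S T => by simp only [Matrix.mul_smul, Matrix.smul_mul, trace_smul]))
  simp only [LinearMap.mk₂_apply] at key
  have h1 : ∑ i : n, ∑ j : n, (single i j (1 : ℂ) * single j i 1 * A).trace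
      = (Fintype.card n : ℂ) * A.trace := by
    have h : ∀ i j : n, (single i j (1 : ℂ) * single j i 1 * A).trace = A i i := fun i j => by
      rw [single_mul_single_same, one_mul, trace_single_mul, one_smul]
    simp_rw [h, sum_const, card_univ, nsmul_eq_mul]
    rw [← mul_sum]
    rfl
  have h2 : ((1 : Matrix n n ℂ) * 1 * A).trace = A.trace := by rw [Matrix.one_mul, Matrix.one_mul]
  rw [key, h1, h2, casimirF]
  field_simp

/-- **Fierz identity for the weighted family:**
`genSum (Z ↦ tr (Z P) tr (Z Q)) = −½ (tr (P Q) − tr P tr Q / N)`. -/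
theorem genSum_trace_mul_trace [Nonempty n] (P Q : Matrix n n ℂ) :
    genSum (fun Z => (Z * P).trace * (Z * Q).trace) =
      -(1 / 2 : ℂ) * ((P * Q).trace - (1 / Fintype.card n : ℂ) * (P.trace * Q.trace)) := by
  have key := genSum_bilin (LinearMap.mk₂ ℂ
    (fun S T : Matrix n n ℂ => (S * P).trace * (T * Q).trace)
    (fun S₁ S₂ T => by simp only [trace_add, add_mul])
    (fun c S T => by simp only [Matrix.smul_mul, trace_smul, smul_eq_mul, mul_assoc])
    (fun S T₁ T₂ => by simp only [add_mul, trace_add, mul_add])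
    (fun c S T => by simp only [Matrix.smul_mul, trace_smul, smul_eq_mul, mul_left_comm]))
  simp only [LinearMap.mk₂_apply] at key
  have h1 : ∑ i : n, ∑ j : n, (single i j (1 : ℂ) * P).trace * (single j i (1 : ℂ) * Q).trace
      = (P * Q).trace := by
    have h : ∀ i j : n, (single i j (1 : ℂ) * P).trace * (single j i (1 : ℂ) * Q).trace
        = P j i * Q i j := fun i j => by
      rw [trace_single_mul, trace_single_mul, one_smul, one_smul]
    simp_rw [h]
    rw [sum_comm]
    simp only [Matrix.trace, Matrix.diag, Matrix.mul_apply]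
  have h2 : ((1 : Matrix n n ℂ) * P).trace * ((1 : Matrix n n ℂ) * Q).trace = P.trace * Q.trace := by
    rw [Matrix.one_mul, Matrix.one_mul]
  rw [key, h1, h2]

/-! ## §5 Real parts of traces against skew-Hermitian matrices -/

omit [DecidableEq n] in
/-- For skew-Hermitian `Z`: `conj tr (Z A) = − tr (Z Aᴴ)`. -/
theorem star_trace_skew_mul {Z : Matrix n n ℂ} (hZ : Zᴴ = -Z) (A : Matrix n n ℂ) :
    star ((Z * A).trace) = -((Z * Aᴴ).trace) := by
  rw [← trace_conjTranspose, conjTranspose_mul, hZ, Matrix.mul_neg, trace_neg, trace_mul_comm]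

omit [DecidableEq n] in
/-- For skew-Hermitian `Z`: `Re tr (Z A) = (tr (Z A) − tr (Z Aᴴ)) / 2` in `ℂ`. -/
theorem re_trace_skew_mul {Z : Matrix n n ℂ} (hZ : Zᴴ = -Z) (A : Matrix n n ℂ) :
    (((Z * A).trace).re : ℂ) = ((Z * A).trace - (Z * Aᴴ).trace) / 2 := by
  rw [Complex.re_eq_add_conj, ← Complex.star_def, star_trace_skew_mul hZ, sub_eq_add_neg]

end Summit.Ventures.LatticeQCDFlow.Exactness
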